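import Summits.BirchSwinnertonDyer.BirchSwinnertonDyer.Theorems.PrintX8MazurTateMuRider
import Literature.NumberTheory.EllipticCurves.PAdicLFunctionIntegralityAtTwoProofs
import HarnessLib

/-!
# Route `PrintX8`, crux `MuBoundSmallImageX8` (stmt-BirchSwinnertonDyer-20622), LINE «vertical Stevens at 3»,
# part 1: the Mazur–Tate element at `p = 3` in the basis `(1+T)ˢ` — its coefficients ARE the plus symbols —
# and THE COLLAPSE LEMMA «a unit symbol `[c/3^{n+1}]⁺_f` ⟹ `θ_n(f) ≢ 0 (mod 3)`»
# (cell `bsd-print-x8`, D-0131 (2) print tier, prover seat p3 g3; `--supports` 20622, closes nothing)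

PARTITION (cell bsd-print-x8, leaf `ClassX8` = `3` good supersingular with `a_3 = ±3`): tools for the
support «VS-G» `GlueOneColourOfCycWindingX8` of the planner's LINE «vertical Stevens at 3»
(`run/shared/lean/pub/bsd-print-x8/plan/vs/LINE-VERTICAL-STEVENS-AT-3.md` §2, `SketchVS.lean` §2); the
per-pair and class-wide theorems are in part 2, `PrintX8VerticalStevensCollapse.lean`.  Closes NO item,
moves 0 census cells; the Birch–Swinnerton-Dyer formula is not proved by any of this.  THEOREMS ONLY over
the tree's real objects (`mazurTateElement`, `ratPlusSymbol`, `red`); no definition, no named fact.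

## Contents (planner memo §2 made exact)

* §1 At `p = 3` the Teichmüller group `μ_τ(ℤ_3)` (`τ = torsionOrder 3 = 2`) is `{1, −1}`
  (`coe_rootsOfUnity_eq_one_or_eq_neg_one`, `sum_rootsOfUnity_eq`).
* §2 Plus symbols: `[−r]⁺ = [r]⁺`, hence `[(−x)/pᴸ]⁺ = [x/pᴸ]⁺` for `x mod pᴸ`; periodicity for natural
  numerators; and the case split `[a/pⁿ]⁺ ∈ {[0]⁺} ∪ {[c/p^{m+1}]⁺ : p ∤ c}` for `a ∈ ℤ`
  (`ratPlusSymbol_intCast_div_pow_cases`) — any `p`.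
* §3 COEFFICIENT EXTRACTION (any `p`): substituting `T = U − 1` in Pollack's
  `θ_n(T) = ∑_η ∑_{s<pⁿ} [η γˢ/p^{n+e₀}]⁺ (1+T)ˢ` (Def. 6.15 = the tree's `mazurTateElement`), the `Uᵏ`
  coefficient of `θ_n ∘ (X − 1)` is `∑_η [η γᵏ/p^{n+e₀}]⁺` (`coeff_comp_mazurTateElement`); at `p = 3` it is
  `2·[γᵏ/3^{n+1}]⁺` (`coeff_comp_mazurTateElement_of_three`) — the «`p = 3` collapse»: no orbit sums.
* §4 THE COLLAPSE LEMMA (`red_ne_zero_of_mazurTate_of_norm_ratPlusSymbol_eq_one`): for a rational newform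
  `f` of level prime to `3` with `a_3 ≢ 1 (mod 3)` every `[b/3ᴸ]⁺_f` is `3`-integral (Sprung 2017 Cor. 4.10
  = the tree's `norm_ratPlusSymbol_div_pow_le_one_of_not_dvd`), so `θ_n = ι(P)`, `P ∈ ℤ_3[T]`; every unit
  `c mod 3^{n+1}` is `±γ^{s₀}` (`classMap_injective` + counting), so a UNIT symbol `[c/3^{n+1}]⁺_f` makes the
  `U^{s₀}`-coefficient `2[γ^{s₀}/3^{n+1}]⁺_f` of `P ∘ (X − 1)` a unit of `ℤ_3`; reduction mod `3` commutes with
  `∘ (X − 1)`, hence `P̄ ≠ 0`, i.e. `red Θ ≠ 0` for the `Θ ∈ Λ` with `ι Θ = θ_n` (so `Θ ≠ 0`, `μ(Θ) = 0`).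

beyond-print: yes (modest; an elementary identity at `p = 3`).  References: [Pollack2003] Def. 6.15;
[Sprung2017] Cor. 4.10; [MazurTateTeitelbaum1986Invent] §I.4 (4.2), §I.8; [Washington1997] §7.2; files
`Literature/…/Sprung2017/SharpFlatPAdicLFunctionProofs.lean`, `Literature/…/PAdicLFunctionInterpolationProofs.lean`,
`Rank1Residual/X1/MuLambdaAlgebra.lean` (`red`), `Theorems/PrintX8MazurTateMuRider.lean` (p546221).
-/

set_option autoImplicit false
-- justification: the mandated namespace `Summit.BirchSwinnertonDyer.BirchSwinnertonDyer.Theorems`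
-- (single-conjunct summit, Sub = Summit) repeats a segment by design (D-0017).
set_option linter.dupNamespace false

noncomputable section

open scoped Classical MatrixGroups ModularForm

open CongruenceSubgroup Polynomial WeierstrassCurve Literature.NumberTheory.EllipticCurves
  Literature.NumberTheory.EllipticCurves.ModularForms
  Literature.NumberTheory.EllipticCurves.Sprung2017
  Literature.NumberTheory.EllipticCurves.Rank1Residual
  Literature.NumberTheory.EllipticCurves.GreenbergVatsal2000
  Summit.BirchSwinnertonDyer.Rank1Residual.X1.MuLambda
  Summit.BirchSwinnertonDyer.Rank1Residual.Supersingular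
  Summit.BirchSwinnertonDyer.BirchSwinnertonDyer.Theorems.PrintX8MazurTateMuRider

namespace Summit.BirchSwinnertonDyer.BirchSwinnertonDyer.Theorems.PrintX8MazurTateThreeCollapse

/-! ### §1. `p = 3`: the Teichmüller representatives are `±1` -/

section Three

variable {p : ℕ} [hp : Fact p.Prime]

/-- `τ(3) = φ(3) = 2`. [folklore] -/
theorem torsionOrder_eq_two (hp3 : p = 3) : torsionOrder p = 2 := by
  subst hp3
  rw [torsionOrder_eq, if_neg (by decide)]

/-- At `p = 3` every Teichmüller representative `η ∈ μ_τ(ℤ_3)` is `1` or `−1`. [folklore] -/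
theorem coe_rootsOfUnity_eq_one_or_eq_neg_one (hp3 : p = 3)
    (ξ : rootsOfUnity (torsionOrder p) ℤ_[p]) :
    ((ξ : ℤ_[p]ˣ) : ℤ_[p]) = 1 ∨ ((ξ : ℤ_[p]ˣ) : ℤ_[p]) = -1 := by
  have key : ∀ x : ℤ_[p], x ^ torsionOrder p = 1 → x = 1 ∨ x = -1 := by
    rw [torsionOrder_eq_two hp3]
    exact fun x hx ↦ sq_eq_one_iff.mp hx
  exact key _ (rootsOfUnity_pow_torsionOrder p ξ)

/-- At `p = 3`: `∑_{η ∈ μ_τ(ℤ_3)} g(η) = g(1) + g(−1)`. [folklore] -/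
theorem sum_rootsOfUnity_eq (hp3 : p = 3) [Fintype (rootsOfUnity (torsionOrder p) ℤ_[p])]
    {M : Type*} [AddCommMonoid M] (g : ℤ_[p] → M) :
    ∑ ξ : rootsOfUnity (torsionOrder p) ℤ_[p], g ((ξ : ℤ_[p]ˣ) : ℤ_[p]) = g 1 + g (-1) := by
  classical
  have hζmem : (-1 : ℤ_[p]ˣ) ∈ rootsOfUnity (torsionOrder p) ℤ_[p] := by
    rw [mem_rootsOfUnity, torsionOrder_eq_two hp3]
    norm_num
  set ζ : rootsOfUnity (torsionOrder p) ℤ_[p] := ⟨-1, hζmem⟩ with hζ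
  have hne : (1 : rootsOfUnity (torsionOrder p) ℤ_[p]) ≠ ζ := by
    intro h
    have h' : (((1 : rootsOfUnity (torsionOrder p) ℤ_[p]) : ℤ_[p]ˣ) : ℤ_[p]) =
        ((ζ : ℤ_[p]ˣ) : ℤ_[p]) := by rw [h]
    rw [hζ] at h'
    simp only [OneMemClass.coe_one, Units.val_one, Units.val_neg] at h'
    have h2 : (2 : ℤ_[p]) = 0 := by linear_combination h'
    exact two_ne_zero h2
  have huniv : (Finset.univ : Finset (rootsOfUnity (torsionOrder p) ℤ_[p])) = {1, ζ} := by
    ext ξ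
    simp only [Finset.mem_univ, Finset.mem_insert, Finset.mem_singleton, true_iff]
    rcases coe_rootsOfUnity_eq_one_or_eq_neg_one hp3 ξ with h | h
    · left
      exact Subtype.ext (Units.ext (by simpa using h))
    · right
      exact Subtype.ext (Units.ext (by rw [hζ]; simpa using h))
  rw [huniv, Finset.sum_pair hne]
  simp only [OneMemClass.coe_one, Units.val_one, hζ, Units.val_neg]

end Three

/-! ### §2. Plus symbols: evenness, periodicity, and the shape of `[a/pⁿ]⁺` for `a ∈ ℤ` -/

section Symbols

variable {N : ℕ} [NeZero N] (f : CuspForm (Gamma0 N) 2) (p : ℕ) [hp : Fact p.Prime]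

/-- `[(−x)/pᴸ]⁺_f = [x/pᴸ]⁺_f` for `x ∈ ℤ/pᴸ` (representatives in `[0, pᴸ)`): evenness and
periodicity (`ratPlusSymbol_neg`, `ratPlusSymbol_add_intCast_eq`). [cite: MazurTateTeitelbaum1986Invent, §I.4 (4.2) and §I.8] -/
theorem ratPlusSymbol_neg_val_div_pow (L : ℕ) (x : ZMod (p ^ L)) :
    ratPlusSymbol f (((-x).val : ℚ) / (p : ℚ) ^ L) = ratPlusSymbol f ((x.val : ℚ) / (p : ℚ) ^ L) := by
  by_cases hx : x = 0
  · subst hx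
    rw [neg_zero]
  haveI : NeZero (p ^ L) := ⟨pow_ne_zero _ hp.out.ne_zero⟩
  have hp0 : (p : ℚ) ^ L ≠ 0 := pow_ne_zero _ (Nat.cast_ne_zero.mpr hp.out.ne_zero)
  have hval : (-x).val = p ^ L - x.val := by rw [ZMod.neg_val, if_neg hx]
  have hle : x.val ≤ p ^ L := (ZMod.val_lt x).le
  have hcast : (((-x).val : ℕ) : ℚ) = (p : ℚ) ^ L - (x.val : ℚ) := by
    rw [hval, Nat.cast_sub hle]
    push_cast
    ring
  have e : (((-x).val : ℕ) : ℚ) / (p : ℚ) ^ L =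
      -((x.val : ℚ) / (p : ℚ) ^ L) + ((1 : ℤ) : ℚ) := by
    rw [hcast]
    push_cast
    field_simp
    ring
  rw [e, ratPlusSymbol_add_intCast_eq, ratPlusSymbol_neg]

/-- Periodicity for natural numerators: `[c/pᴸ]⁺_f = [(c mod pᴸ)/pᴸ]⁺_f`.
[cite: MazurTateTeitelbaum1986Invent, §I.4 (4.2)] -/
theorem ratPlusSymbol_natCast_div_pow_eq_val (L c : ℕ) :
    ratPlusSymbol f ((c : ℚ) / (p : ℚ) ^ L) =
      ratPlusSymbol f (((c : ZMod (p ^ L)).val : ℚ) / (p : ℚ) ^ L) := by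
  haveI : NeZero (p ^ L) := ⟨pow_ne_zero _ hp.out.ne_zero⟩
  have hp0 : (p : ℚ) ^ L ≠ 0 := pow_ne_zero _ (Nat.cast_ne_zero.mpr hp.out.ne_zero)
  rw [ZMod.val_natCast]
  have hc : (c : ℚ) = ((c % p ^ L : ℕ) : ℚ) + (p : ℚ) ^ L * ((c / p ^ L : ℕ) : ℚ) := by
    exact_mod_cast (Nat.mod_add_div c (p ^ L)).symm
  have e : (c : ℚ) / (p : ℚ) ^ L =
      ((c % p ^ L : ℕ) : ℚ) / (p : ℚ) ^ L + (((c / p ^ L : ℕ) : ℤ) : ℚ) := by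
    rw [hc, Int.cast_natCast]
    field_simp
  rw [e, ratPlusSymbol_add_intCast_eq]

/-- **The shape of `[a/pⁿ]⁺_f` for an integer `a`**: either it is `[0]⁺_f` (when `pⁿ ∣ a`), or it is
`[c/p^{m+1}]⁺_f` for some `m` and some natural `c` prime to `p` (reduce the fraction and the numerator
modulo the denominator; periodicity `[r + 1]⁺ = [r]⁺`). [cite: MazurTateTeitelbaum1986Invent, §I.4 (4.2)] -/
theorem ratPlusSymbol_intCast_div_pow_cases (n : ℕ) (a : ℤ) :
    ratPlusSymbol f ((a : ℚ) / (p : ℚ) ^ n) = ratPlusSymbol f 0 ∨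
      ∃ m c : ℕ, ¬ p ∣ c ∧
        ratPlusSymbol f ((a : ℚ) / (p : ℚ) ^ n) = ratPlusSymbol f ((c : ℚ) / (p : ℚ) ^ (m + 1)) := by
  have hp0 : (p : ℚ) ≠ 0 := Nat.cast_ne_zero.mpr hp.out.ne_zero
  induction n generalizing a with
  | zero =>
    left
    rw [pow_zero, div_one, show (a : ℚ) = 0 + ((a : ℤ) : ℚ) by ring, ratPlusSymbol_add_intCast_eq]
  | succ n ih =>
    by_cases hpa : (p : ℤ) ∣ a
    · obtain ⟨b, rfl⟩ := hpa
      have e : ((p * b : ℤ) : ℚ) / (p : ℚ) ^ (n + 1) = (b : ℚ) / (p : ℚ) ^ n := by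
        push_cast
        rw [pow_succ]
        field_simp
      rw [e]
      exact ih b
    · right
      set M : ℤ := (p : ℤ) ^ (n + 1) with hM
      have hM0 : M ≠ 0 := pow_ne_zero _ (by exact_mod_cast hp.out.ne_zero)
      have hr0 : 0 ≤ a % M := Int.emod_nonneg a hM0
      have ht : (((a % M).toNat : ℕ) : ℤ) = a % M := Int.toNat_of_nonneg hr0
      have hdiv : a % M + M * (a / M) = a := Int.emod_add_mul_ediv a M
      refine ⟨n, (a % M).toNat, ?_, ?_⟩
      · intro hdvd
        apply hpa
        have h1 : (p : ℤ) ∣ a % M := by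
          rw [← ht]
          exact_mod_cast hdvd
        have h2 : (p : ℤ) ∣ M := dvd_pow_self (p : ℤ) (Nat.succ_ne_zero n)
        rw [← hdiv]
        exact dvd_add h1 (dvd_mul_of_dvd_left h2 _)
      · have hdecomp : (a : ℚ) = (((a % M).toNat : ℕ) : ℚ) + (M : ℚ) * ((a / M : ℤ) : ℚ) := by
          have h : a = (((a % M).toNat : ℕ) : ℤ) + M * (a / M) := by rw [ht]; exact hdiv.symm
          have h' := congr_arg (Int.cast : ℤ → ℚ) h
          push_cast at h'
          exact h'
        have e : (a : ℚ) / (p : ℚ) ^ (n + 1) =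
            (((a % M).toNat : ℕ) : ℚ) / (p : ℚ) ^ (n + 1) + ((a / M : ℤ) : ℚ) := by
          rw [hdecomp, hM]
          push_cast
          field_simp
        rw [e, ratPlusSymbol_add_intCast_eq]

end Symbols

/-! ### §3. Coefficient extraction: `θ_n(f, U − 1) = ∑_η ∑_{s<pⁿ} [η γˢ/p^{n+e₀}]⁺ Uˢ` -/

section Coefficients

variable {N : ℕ} (f : CuspForm (Gamma0 N) 2) {p : ℕ} [hp : Fact p.Prime]

/-- **The `Uᵏ`-coefficient of `θ_n(U − 1)`** (`k < pⁿ`): `∑_η [η γᵏ/p^{n+e₀}]⁺_f`, summed over the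
Teichmüller representatives `η`.  Substituting `T = U − 1` in Pollack's
`θ_n(T) = ∑_η ∑_{s<pⁿ} [η γˢ/p^{n+e₀}]⁺ (1+T)ˢ` (Def. 6.15, the tree's `mazurTateElement`) gives the
monomial expansion, and the classes `s mod pⁿ` have distinct representatives `s < pⁿ`.
[cite: Pollack2003, Def. 6.15] -/
theorem coeff_comp_mazurTateElement [Fintype (rootsOfUnity (torsionOrder p) ℤ_[p])] (n : ℕ)
    {k : ℕ} (hk : k < p ^ n) :
    ((mazurTateElement f p n).comp (X - 1)).coeff k =
      ∑ ξ : rootsOfUnity (torsionOrder p) ℤ_[p], ratPlusSymbol f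
        (((PadicInt.toZModPow (n + cyclotomicExponent p) ((ξ : ℤ_[p]ˣ) : ℤ_[p]) *
            (cyclotomicGenerator p : ZMod (p ^ (n + cyclotomicExponent p))) ^ k).val : ℚ) /
          (p : ℚ) ^ (n + cyclotomicExponent p)) := by
  classical
  haveI : NeZero (p ^ n) := ⟨pow_ne_zero _ hp.out.ne_zero⟩
  have hX1 : compRingHom (X - 1 : ℚ[X]) (X + 1) = X := by
    rw [coe_compRingHom_apply, add_comp, X_comp, one_comp, sub_add_cancel]
  rw [← coe_compRingHom_apply, mazurTateElement, finsum_eq_sum_of_fintype, map_sum,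
    finsetSum_coeff]
  refine Finset.sum_congr rfl fun ξ _ ↦ ?_
  rw [map_sum, finsetSum_coeff]
  simp_rw [map_mul, map_pow, hX1, coe_compRingHom_apply, C_comp, coeff_C_mul_X_pow]
  rw [Finset.sum_eq_single (k : ZMod (p ^ n))]
  · rw [ZMod.val_cast_of_lt hk, if_pos rfl]
  · intro s _ hs
    rw [if_neg]
    intro hks
    apply hs
    rw [hks, ZMod.natCast_zmod_val]
  · intro h
    exact absurd (Finset.mem_univ _) h

variable [NeZero N]

/-- **At `p = 3` the `Uᵏ`-coefficient of `θ_n(U − 1)` is `2·[γᵏ/3^{n+1}]⁺_f`** (`k < 3ⁿ`): the two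
Teichmüller representatives `±1` contribute `[γᵏ/3^{n+1}]⁺ + [−γᵏ/3^{n+1}]⁺`, and `[−r]⁺ = [r]⁺`.  So at
`p = 3` the coefficients of the Mazur–Tate element in the basis `(1+T)ˢ` ARE the plus symbols (no orbit
sums): the «`p = 3` collapse» of the planner memo §2. [cite: Pollack2003, Def. 6.15] [cite: MazurTateTeitelbaum1986Invent, §I.8] -/
theorem coeff_comp_mazurTateElement_of_three (hp3 : p = 3)
    [Fintype (rootsOfUnity (torsionOrder p) ℤ_[p])] (n : ℕ) {k : ℕ} (hk : k < p ^ n) :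
    ((mazurTateElement f p n).comp (X - 1)).coeff k =
      2 * ratPlusSymbol f
        ((((cyclotomicGenerator p : ZMod (p ^ (n + cyclotomicExponent p))) ^ k).val : ℚ) /
          (p : ℚ) ^ (n + cyclotomicExponent p)) := by
  rw [coeff_comp_mazurTateElement f n hk]
  have h := sum_rootsOfUnity_eq hp3 (fun x : ℤ_[p] ↦ ratPlusSymbol f
    (((PadicInt.toZModPow (n + cyclotomicExponent p) x *
        (cyclotomicGenerator p : ZMod (p ^ (n + cyclotomicExponent p))) ^ k).val : ℚ) /
      (p : ℚ) ^ (n + cyclotomicExponent p)))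
  rw [h, map_one, one_mul, map_neg, map_one, neg_one_mul, ratPlusSymbol_neg_val_div_pow, two_mul]

end Coefficients

/-! ### §4. THE COLLAPSE: a unit symbol `[c/3^{n+1}]⁺_f` gives `red Θ_n ≠ 0` -/

section Collapse

variable {N : ℕ} [NeZero N] (f : CuspForm (Gamma0 N) 2) {p : ℕ} [hp : Fact p.Prime]

/-- **The `p = 3` collapse.**  Let `p = 3`, `f` a rational newform (`IsNewform0`) of level `N`
prime to `3` with `a_3(f) = a_3 ≢ 1 (mod 3)`, `Θ ∈ Λ = ℤ_3⟦T⟧` an integral model of the Mazur–Tate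
element `θ_n(f)` (`ι Θ = θ_n`), and `c` prime to `3` with `[c/3^{n+1}]⁺_f` a `3`-adic UNIT.  Then
`red Θ ≠ 0` (i.e. `Θ ≢ 0 (mod 3)`, so `Θ ≠ 0` and `μ(Θ) = 0`).
Proof: every `[b/3ᴸ]⁺_f` is `3`-integral (Sprung 2017 Cor. 4.10: `a_3 ≢ 1`), so `θ_n = ι P`, `P ∈ ℤ_3[T]`
(`exists_map_eq_map_mazurTateElement_of_not_dvd`) and `P = Θ`; the unit class `c mod 3^{n+1}` is
`±γ^{s₀}` for a unique `s₀ < 3ⁿ` (`classMap_injective` and counting), and `[−x]⁺ = [x]⁺`, so the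
`U^{s₀}`-coefficient `2·[γ^{s₀}/3^{n+1}]⁺_f` of `P(U − 1)` (`coeff_comp_mazurTateElement_of_three`) is a
unit of `ℤ_3`; reduction modulo `3` commutes with the substitution `T = U − 1`, hence `P̄ ≠ 0`.
[cite: Pollack2003, Def. 6.15] [cite: Sprung2017, Cor. 4.10] [cite: MazurTateTeitelbaum1986Invent, §I.8] -/
theorem red_ne_zero_of_mazurTate_of_norm_ratPlusSymbol_eq_one (hp3 : p = 3) (hf0 : IsNewform0 f)
    (hpN : ¬ p ∣ N) {ap : ℤ} (hap : cuspCoeff f p = ap) (hpa : ¬ (p : ℤ) ∣ ap - 1)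
    {n : ℕ} {Θ : IwasawaAlgebra p}
    (hΘ : iwasawaToPowerSeries p Θ =
      ((mazurTateElement f p n).map (algebraMap ℚ ℚ_[p]) : PowerSeries ℚ_[p]))
    {c : ℕ} (hc : ¬ p ∣ c)
    (hunit : ‖((ratPlusSymbol f ((c : ℚ) / (p : ℚ) ^ (n + cyclotomicExponent p)) : ℚ) : ℚ_[p])‖ = 1) :
    red Θ ≠ 0 := by
  classical
  have hp2 : p ≠ 2 := by omega
  haveI := neZero_torsionOrder p
  haveI : Fintype (rootsOfUnity (torsionOrder p) ℤ_[p]) := Fintype.ofFinite _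
  haveI : NeZero (p ^ n) := ⟨pow_ne_zero _ hp.out.ne_zero⟩
  haveI : NeZero (p ^ (n + cyclotomicExponent p)) := ⟨pow_ne_zero _ hp.out.ne_zero⟩
  -- (1) the unit class of `c` modulo `p^{n+e₀}` is `ξ₀ γ^{s₀}`
  have hcop : Nat.Coprime c (p ^ (n + cyclotomicExponent p)) :=
    Nat.Coprime.pow_right _ ((Nat.Prime.coprime_iff_not_dvd hp.out).mpr hc).symm
  set Φ : rootsOfUnity (torsionOrder p) ℤ_[p] × ZMod (p ^ n) →
      (ZMod (p ^ (n + cyclotomicExponent p)))ˣ := fun x ↦ (isUnit_classMap p n x).unit with hΦ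
  have hΦinj : Function.Injective Φ := by
    intro x y hxy
    have h := congr_arg Units.val hxy
    simp only [hΦ, IsUnit.unit_spec] at h
    exact classMap_injective p n h
  have hΦbij : Function.Bijective Φ :=
    (Fintype.bijective_iff_injective_and_card Φ).mpr ⟨hΦinj, card_classDomain p n⟩
  obtain ⟨⟨ξ₀, s₀⟩, hηs⟩ := hΦbij.2 (ZMod.unitOfCoprime c hcop)
  have hclass : PadicInt.toZModPow (n + cyclotomicExponent p) ((ξ₀ : ℤ_[p]ˣ) : ℤ_[p]) *
      (cyclotomicGenerator p : ZMod (p ^ (n + cyclotomicExponent p))) ^ s₀.val =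
        (c : ZMod (p ^ (n + cyclotomicExponent p))) := by
    have h := congr_arg Units.val hηs
    simp only [hΦ, IsUnit.unit_spec, ZMod.coe_unitOfCoprime] at h
    exact h
  -- (2) the symbol of `γ^{s₀}` is a `p`-adic unit
  have hsym : ‖((ratPlusSymbol f
      ((((cyclotomicGenerator p : ZMod (p ^ (n + cyclotomicExponent p))) ^ s₀.val).val : ℚ) /
        (p : ℚ) ^ (n + cyclotomicExponent p)) : ℚ) : ℚ_[p])‖ = 1 := by
    have hcval := ratPlusSymbol_natCast_div_pow_eq_val f p (n + cyclotomicExponent p) c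
    rcases coe_rootsOfUnity_eq_one_or_eq_neg_one hp3 ξ₀ with h1 | h1
    · rw [h1, map_one, one_mul] at hclass
      rw [hclass, ← hcval]
      exact hunit
    · rw [h1, map_neg, map_one, neg_one_mul] at hclass
      rw [← ratPlusSymbol_neg_val_div_pow f p (n + cyclotomicExponent p), hclass, ← hcval]
      exact hunit
  -- (3) the `U^{s₀}`-coefficient of `θ_n(U - 1)` has norm `1`
  have hMnorm : ‖((((mazurTateElement f p n).comp (X - 1)).coeff s₀.val : ℚ) : ℚ_[p])‖ = 1 := by
    rw [coeff_comp_mazurTateElement_of_three f hp3 n (ZMod.val_lt s₀), Rat.cast_mul, norm_mul, hsym,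
      mul_one, Rat.cast_ofNat]
    have h2 : ‖((2 : ℕ) : ℚ_[p])‖ = 1 :=
      Padic.norm_natCast_eq_one_iff.mpr ((Nat.coprime_primes hp.out Nat.prime_two).mpr hp2)
    rw [Nat.cast_ofNat] at h2
    exact h2
  -- (4) the integral model as a polynomial `P ∈ ℤ_p[T]`, `P = Θ`
  obtain ⟨P, hP⟩ := exists_map_eq_map_mazurTateElement_of_not_dvd hp2 hf0 hpN hap hpa n
  have hPΘ : (P : PowerSeries ℤ_[p]) = Θ := by
    apply iwasawaToPowerSeries_injective p
    rw [hΘ, ← hP, Polynomial.polynomial_map_coe]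
  -- the `U^{s₀}`-coefficient of `P(U - 1)` is a unit of `ℤ_p`
  have hcoeff : IsUnit ((P.comp (X - 1)).coeff s₀.val) := by
    rw [PadicInt.isUnit_iff, PadicInt.norm_def]
    have h2 : (P.comp (X - 1)).map (algebraMap ℤ_[p] ℚ_[p]) =
        ((mazurTateElement f p n).comp (X - 1)).map (algebraMap ℚ ℚ_[p]) := by
      rw [Polynomial.map_comp, Polynomial.map_comp, hP, Polynomial.map_sub, Polynomial.map_sub,
        Polynomial.map_X, Polynomial.map_X, Polynomial.map_one, Polynomial.map_one]
    have h3 := congr_arg (fun q ↦ Polynomial.coeff q s₀.val) h2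
    simp only [Polynomial.coeff_map, eq_ratCast] at h3
    change ‖algebraMap ℤ_[p] ℚ_[p] ((P.comp (X - 1)).coeff s₀.val)‖ = 1
    rw [h3]
    exact hMnorm
  -- (5) reduction modulo `p` commutes with `T = U - 1`
  intro hred
  have hPred : P.map (IsLocalRing.residue ℤ_[p]) = 0 := by
    apply Polynomial.coe_injective
    rw [Polynomial.polynomial_map_coe, hPΘ, Polynomial.coe_zero]
    exact hred
  have h0 : IsLocalRing.residue ℤ_[p] ((P.comp (X - 1)).coeff s₀.val) = 0 := by
    rw [← Polynomial.coeff_map, Polynomial.map_comp, hPred, zero_comp, Polynomial.coeff_zero]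
  exact (IsLocalRing.residue_ne_zero_iff_isUnit _).mpr hcoeff h0

end Collapse

end Summit.BirchSwinnertonDyer.BirchSwinnertonDyer.Theorems.PrintX8MazurTateThreeCollapse

end
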